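import Mathlib
import Literature.Computability.AlgebraicComplexity.GroupTheoreticMatMul
import Summits.MatrixMultiplication.MatrixMultiplication.Theorems.GroupTheoreticSTPPCAbelianObstructionNegSecondMoment
import Summits.MatrixMultiplication.MatrixMultiplication.Theorems.AbelianSTPPSieve

/-!
# The `T_E` residual instances of the abelian STPP census, killed by the second-moment certificate

Support file for route `MatrixMultiplication/GroupTheoreticSTPP`, negative crux
`stmt-MatrixMultiplication-0596` (`CAbelianObstructionNeg`), finite-range evidence; cell mm-stpp, rung F-M1,
HOME/CENSUS-PLAN.md §6.1 (questions Q3.8–Q3.12) and the route draft `AbelianSTPPCensus`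
(HOME/mm-stpp-plan/route/Sketch.lean: cruxes `TEOrder125`, `TEResidualSmall`, `TEResidualLarge`, whose
statements are proved here verbatim as `AbelianTECensus.teOrder125 / teResidualSmall / teResidualLarge`
over the census vocabulary of `AbelianSTPPSieve.lean`, p406174).

`STPPSlack.false_of_certificate_C` turns the certificate of `…NegSecondMoment.lean` into a kill schema: an
STPP family with prescribed positive shapes `(a r, b r, c r)_{r < k}` in an abelian group of order `M`
cannot exist if no `D ∈ [Σab, M]` with `3Σab ≤ 2D ∨ D ∣ M` satisfies
`Σbc + (D − 1)(2Σbc + Σca − M − 2m) ≤ (Σbc)²` (a `decide`-able arithmetic statement).  The nine residual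
sub-multisets of the `T_E` (`τ = 5/2`) census at abelian orders `≤ 127` all fail it in one rotation:

| order(s) | shapes | form | `Σab, Σbc, Σca, m, L` |
|---|---|---|---|
| 124–127 | `(4,4,4)×4` | C | `64, 64, 64, 4, 184 − M` |
| 125 | `(5,5,3),(5,3,5),(3,5,5),(3,3,3)` | C | `64, 64, 64, 5, 57` |
| 111 | `(4,4,4)×3,(3,3,3)` | C | `57, 57, 57, 4, 52` |
| 120, 121 | `(4,4,4)×3,(4,4,3)` / `(4,3,4)` / `(3,4,4)` | C / B / A | `64, 60, 60, 4, 172 − M` |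
| 124 | `(5,4,3),(3,4,5),(4,4,4)×2` | C | `64, 64, 62, 5, 56` |
| 124 | `(5,3,4),(3,5,4),(4,4,4)×2` | A | `64, 64, 62, 5, 56` |
| 124 | `(4,5,3),(4,3,5),(4,4,4)×2` | C | `64, 62, 64, 5, 54` |

In every row `Σab > M/2`, so `D ∣ M` forces `D = M`, and `D ≥ ⌈3Σab/2⌉` resp. `D = M` makes
`Σbc + (D − 1)L` exceed `(Σbc)²`.  The order-125 row `(4,4,4)×4` is eng-1's THEOREM B (p403556/p403830,
a different proof); 111/120 were first excluded by hand with Kneser's theorem (lit seat,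
HOME/mm-stpp-lit/KNESER-KILLS.md §3), 121/124/126/127 by the lit seat's U11-Δ with Kneser (§4) and 125
`(5,5,3)…` by the planner's slack-run argument (Q38-SLACK-PROOF.md); here all nine are kernel theorems with
no Kneser input.

WHAT THIS IS NOT: no `ω` statement; finite instances of a necessary condition.  The route cruxes close
formally only by files whose theorem TYPE is the route decl, once route `AbelianSTPPCensus` is open.
-/

-- single-conjunct summit: the mandated namespace repeats `MatrixMultiplication`.
set_option linter.dupNamespace false

namespace Summit.MatrixMultiplication.MatrixMultiplication.Theorems

/-! ### The arithmetic kill schema and the `T_E` residual instances -/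

namespace STPPSlack

open Finset Literature.Computability.AlgebraicComplexity
open scoped Pointwise

variable {H : Type*} [AddCommGroup H] [Fintype H] {k : ℕ} {A B C : Fin k → Finset H}

/-- **Kill schema (`C`-form).** If the shape data `(a, b, c)` of an STPP family with positive sizes admits
NO certificate value `D ∈ [Σab, M]` with `3Σab ≤ 2D ∨ D ∣ M` and
`Σbc + (D − 1)(2Σbc + Σca − M − 2m) ≤ (Σbc)²` (`m ≥` all `c r`), the family does not exist. [original] -/
theorem false_of_certificate_C (h : IsSTPP A B C) {a b c : Fin k → ℕ}
    (hA : ∀ r, (A r).card = a r) (hB : ∀ r, (B r).card = b r) (hC : ∀ r, (C r).card = c r)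
    (hpos : ∀ r, 0 < a r ∧ 0 < b r ∧ 0 < c r) {M m Sab Sbc Sca : ℕ} (hM : Fintype.card H = M)
    (hm : ∀ r, c r ≤ m) (hab : ∑ r, a r * b r = Sab) (hbc : ∑ r, b r * c r = Sbc)
    (hca : ∑ r, a r * c r = Sca)
    (hfail : ∀ D ∈ Finset.Icc Sab M, (3 * Sab ≤ 2 * D ∨ D ∣ M) →
      Sbc * Sbc < Sbc + (D - 1) * (2 * Sbc + Sca - (M + 2 * m))) : False := by
  classical
  have hA' : ∀ r, (A r).Nonempty := fun r => card_pos.1 (by rw [hA r]; exact (hpos r).1)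
  have hB' : ∀ r, (B r).Nonempty := fun r => card_pos.1 (by rw [hB r]; exact (hpos r).2.1)
  have hC' : ∀ r, (C r).Nonempty := fun r => card_pos.1 (by rw [hC r]; exact (hpos r).2.2)
  have hm' : ∀ r, (C r).card ≤ m := fun r => by rw [hC r]; exact hm r
  obtain ⟨D, h1, h2, h3, h4⟩ := certificate_C h hA' hB' hC' hm'
  simp only [hA, hB, hC, hab, hbc, hca, hM] at h1 h2 h3 h4
  have := hfail D (mem_Icc.2 ⟨h1, h2⟩) h3
  omega

omit [Fintype H] in
/-- Restriction of an STPP family along four distinct indices with prescribed shapes: a `Fin 4`-indexed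
STPP family with those shapes. [bookkeeping] -/
theorem restrict_four {N : ℕ} {A B C : Fin N → Finset H} (h : IsSTPP A B C) (φ : Fin 4 ↪ Fin N) :
    IsSTPP (fun r => A (φ r)) (fun r => B (φ r)) (fun r => C (φ r)) := by
  intro i j l s hs s' hs' t ht t' ht' u hu u' hu' he
  obtain ⟨h1, h2, h3, h4, h5⟩ := h (φ i) (φ j) (φ l) s hs s' hs' t ht t' ht' u hu u' hu' he
  exact ⟨φ.injective h1, φ.injective h2, h3, h4, h5⟩

/-- **Four `(4,4,4)` members, orders `124 ≤ M ≤ 127`: impossible** (Q3.11/Q3.12 `{(4,4,4)×4}` at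
124/126/127 and eng-1's THEOREM B at 125, uniformly): `Σ = 64`, `m = 4`, `L = 184 − M`, no `D ∈ [64, M]`
with `D ≥ 96 ∨ D ∣ M` satisfies `64 + (D − 1)L ≤ 4096`. [original] -/
theorem no_four444 {A B C : Fin 4 → Finset H} (h : IsSTPP A B C) (hA : ∀ r, (A r).card = 4)
    (hB : ∀ r, (B r).card = 4) (hC : ∀ r, (C r).card = 4) (hM : 124 ≤ Fintype.card H)
    (hM' : Fintype.card H ≤ 127) : False := by
  obtain ⟨M, hMe⟩ : ∃ M, Fintype.card H = M := ⟨_, rfl⟩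
  rw [hMe] at hM hM'
  have key : ∀ M, 124 ≤ M → M ≤ 127 → Fintype.card H = M → False := by
    intro M hM hM' hMe
    refine false_of_certificate_C h (a := fun _ => 4) (b := fun _ => 4) (c := fun _ => 4) hA hB hC
      (fun _ => by norm_num) hMe (m := 4) (fun _ => le_rfl) (Sab := 64) (Sbc := 64) (Sca := 64)
      (by simp) (by simp) (by simp) ?_
    interval_cases M <;> decide
  exact key M hM hM' hMe

/-- **Order 125, shapes `(5,5,3),(5,3,5),(3,5,5),(3,3,3)`: impossible** (Q3.8; third proof after the
planner's Q38-SLACK-PROOF and the lit seat's Kneser argument): `C`-form `Σab = Σbc = Σca = 64`, `m = 5`,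
`L = 57`. [original] -/
theorem no_553_535_355_333 {A B C : Fin 4 → Finset H} (h : IsSTPP A B C)
    (hA : ∀ r, (A r).card = ![5, 5, 3, 3] r) (hB : ∀ r, (B r).card = ![5, 3, 5, 3] r)
    (hC : ∀ r, (C r).card = ![3, 5, 5, 3] r) (hM : Fintype.card H = 125) : False :=
  false_of_certificate_C h hA hB hC (by decide) hM (m := 5) (by decide) (Sab := 64) (Sbc := 64)
    (Sca := 64) (by decide) (by decide) (by decide) (by decide)

/-- **Order 111, shapes `(4,4,4)×3,(3,3,3)`: impossible** (Q3.9; the lit seat's first Kneser kill):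
`C`-form `Σ = 57`, `m = 4`, `L = 52`; `D ∈ [57,111]`, `D ≥ 86 ∨ D ∣ 111`. [original] -/
theorem no_444_444_444_333 {A B C : Fin 4 → Finset H} (h : IsSTPP A B C)
    (hA : ∀ r, (A r).card = ![4, 4, 4, 3] r) (hB : ∀ r, (B r).card = ![4, 4, 4, 3] r)
    (hC : ∀ r, (C r).card = ![4, 4, 4, 3] r) (hM : Fintype.card H = 111) : False :=
  false_of_certificate_C h hA hB hC (by decide) hM (m := 4) (by decide) (Sab := 57) (Sbc := 57)
    (Sca := 57) (by decide) (by decide) (by decide) (by decide)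

/-- **Orders 120 and 121, shapes `(4,4,4)×3,(4,4,3)`: impossible** (Q3.10): `C`-form `Σab = 64`,
`Σbc = Σca = 60`, `m = 4`, `L = 172 − M`. [original] -/
theorem no_444_444_444_443 {A B C : Fin 4 → Finset H} (h : IsSTPP A B C)
    (hA : ∀ r, (A r).card = ![4, 4, 4, 4] r) (hB : ∀ r, (B r).card = ![4, 4, 4, 4] r)
    (hC : ∀ r, (C r).card = ![4, 4, 4, 3] r) (hM : Fintype.card H = 120 ∨ Fintype.card H = 121) :
    False := by
  rcases hM with hM | hM
  · exact false_of_certificate_C h hA hB hC (by decide) hM (m := 4) (by decide) (Sab := 64)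
      (Sbc := 60) (Sca := 60) (by decide) (by decide) (by decide) (by decide)
  · exact false_of_certificate_C h hA hB hC (by decide) hM (m := 4) (by decide) (Sab := 64)
      (Sbc := 60) (Sca := 60) (by decide) (by decide) (by decide) (by decide)

/-- **Orders 120 and 121, shapes `(4,4,4)×3,(4,3,4)`: impossible** (Q3.10): `B`-form (rotation
`(C, A, B)`, whose `Σab` is `Σca = 64`). [original] -/
theorem no_444_444_444_434 {A B C : Fin 4 → Finset H} (h : IsSTPP A B C)
    (hA : ∀ r, (A r).card = ![4, 4, 4, 4] r) (hB : ∀ r, (B r).card = ![4, 4, 4, 3] r)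
    (hC : ∀ r, (C r).card = ![4, 4, 4, 4] r) (hM : Fintype.card H = 120 ∨ Fintype.card H = 121) :
    False := by
  rcases hM with hM | hM
  · exact false_of_certificate_C h.rotate.rotate hC hA hB (by decide) hM (m := 4) (by decide)
      (Sab := 64) (Sbc := 60) (Sca := 60) (by decide) (by decide) (by decide) (by decide)
  · exact false_of_certificate_C h.rotate.rotate hC hA hB (by decide) hM (m := 4) (by decide)
      (Sab := 64) (Sbc := 60) (Sca := 60) (by decide) (by decide) (by decide) (by decide)

/-- **Orders 120 and 121, shapes `(4,4,4)×3,(3,4,4)`: impossible** (Q3.10): `A`-form (rotation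
`(B, C, A)`, whose `Σab` is `Σbc = 64`). [original] -/
theorem no_444_444_444_344 {A B C : Fin 4 → Finset H} (h : IsSTPP A B C)
    (hA : ∀ r, (A r).card = ![4, 4, 4, 3] r) (hB : ∀ r, (B r).card = ![4, 4, 4, 4] r)
    (hC : ∀ r, (C r).card = ![4, 4, 4, 4] r) (hM : Fintype.card H = 120 ∨ Fintype.card H = 121) :
    False := by
  rcases hM with hM | hM
  · exact false_of_certificate_C h.rotate hB hC hA (by decide) hM (m := 4) (by decide)
      (Sab := 64) (Sbc := 60) (Sca := 60) (by decide) (by decide) (by decide) (by decide)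
  · exact false_of_certificate_C h.rotate hB hC hA (by decide) hM (m := 4) (by decide)
      (Sab := 64) (Sbc := 60) (Sca := 60) (by decide) (by decide) (by decide) (by decide)

/-- **Order 124, shapes `(5,4,3),(3,4,5),(4,4,4),(4,4,4)`: impossible** (Q3.11): `C`-form `Σab = Σbc = 64`,
`Σca = 62`, `m = 5`, `L = 56`. [original] -/
theorem no_543_345_444_444 {A B C : Fin 4 → Finset H} (h : IsSTPP A B C)
    (hA : ∀ r, (A r).card = ![5, 3, 4, 4] r) (hB : ∀ r, (B r).card = ![4, 4, 4, 4] r)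
    (hC : ∀ r, (C r).card = ![3, 5, 4, 4] r) (hM : Fintype.card H = 124) : False :=
  false_of_certificate_C h hA hB hC (by decide) hM (m := 5) (by decide) (Sab := 64) (Sbc := 64)
    (Sca := 62) (by decide) (by decide) (by decide) (by decide)

/-- **Order 124, shapes `(5,3,4),(3,5,4),(4,4,4),(4,4,4)`: impossible** (Q3.11, rotation): `A`-form.
[original] -/
theorem no_534_354_444_444 {A B C : Fin 4 → Finset H} (h : IsSTPP A B C)
    (hA : ∀ r, (A r).card = ![5, 3, 4, 4] r) (hB : ∀ r, (B r).card = ![3, 5, 4, 4] r)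
    (hC : ∀ r, (C r).card = ![4, 4, 4, 4] r) (hM : Fintype.card H = 124) : False :=
  false_of_certificate_C h.rotate hB hC hA (by decide) hM (m := 5) (by decide) (Sab := 64)
    (Sbc := 64) (Sca := 62) (by decide) (by decide) (by decide) (by decide)

/-- **Order 124, shapes `(4,5,3),(4,3,5),(4,4,4),(4,4,4)`: impossible** (Q3.11, rotation): `C`-form
`Σab = 64`, `Σbc = 62`, `Σca = 64`, `m = 5`, `L = 54`. [original] -/
theorem no_453_435_444_444 {A B C : Fin 4 → Finset H} (h : IsSTPP A B C)
    (hA : ∀ r, (A r).card = ![4, 4, 4, 4] r) (hB : ∀ r, (B r).card = ![5, 3, 4, 4] r)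
    (hC : ∀ r, (C r).card = ![3, 5, 4, 4] r) (hM : Fintype.card H = 124) : False :=
  false_of_certificate_C h hA hB hC (by decide) hM (m := 5) (by decide) (Sab := 64) (Sbc := 62)
    (Sca := 64) (by decide) (by decide) (by decide) (by decide)

end STPPSlack

/-! ### The residual instances in the census vocabulary (`NoSTPPSubfamily`) -/

namespace AbelianTECensus

open Finset Literature.Computability.AlgebraicComplexity STPPSlack

variable {H : Type*} [AddCommGroup H] {N : ℕ} {A B C : Fin N → Finset H}

/-- From `HasSubfamilyShapes A B C [x₀, x₁, x₂, x₃]`: a `Fin 4`-indexed STPP sub-family with exactly these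
shapes (restriction along the embedding). [bookkeeping] -/
theorem exists_four_of_hasSubfamilyShapes (h : IsSTPP A B C) {x₀ x₁ x₂ x₃ : ℕ × ℕ × ℕ}
    (hs : HasSubfamilyShapes A B C [x₀, x₁, x₂, x₃]) :
    ∃ A' B' C' : Fin 4 → Finset H, IsSTPP A' B' C' ∧
      (∀ r, (A' r).card = ![x₀.1, x₁.1, x₂.1, x₃.1] r) ∧
      (∀ r, (B' r).card = ![x₀.2.1, x₁.2.1, x₂.2.1, x₃.2.1] r) ∧
      (∀ r, (C' r).card = ![x₀.2.2, x₁.2.2, x₂.2.2, x₃.2.2] r) := by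
  obtain ⟨φ, hφ⟩ := hs
  have e : ∀ r : Fin 4, ((A (φ r)).card, (B (φ r)).card, (C (φ r)).card) = ![x₀, x₁, x₂, x₃] r := by
    intro r
    have := hφ r
    fin_cases r <;> exact this
  refine ⟨fun r => A (φ r), fun r => B (φ r), fun r => C (φ r), restrict_four h φ, ?_, ?_, ?_⟩
  · intro r; have := congrArg Prod.fst (e r); fin_cases r <;> exact this
  · intro r; have := congrArg (fun p => p.2.1) (e r); fin_cases r <;> exact this
  · intro r; have := congrArg (fun p => p.2.2) (e r); fin_cases r <;> exact this

/-- **Orders 124–127: no STPP family in an abelian group of such order has four `(4,4,4)` members.**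
(124, 126, 127 = Q3.11/Q3.12 `{(4,4,4)×4}`; 125 = eng-1's THEOREM B, here re-proved by the certificate.)
[original] -/
theorem noSTPPSubfamily_four444 {M : ℕ} (hM : 124 ≤ M) (hM' : M ≤ 127) :
    NoSTPPSubfamily M [(4,4,4),(4,4,4),(4,4,4),(4,4,4)] := by
  intro H _ _ hH N A B C h hs
  obtain ⟨A', B', C', h', hA, hB, hC⟩ := exists_four_of_hasSubfamilyShapes h hs
  exact no_four444 h' (fun r => by have := hA r; fin_cases r <;> exact this)
    (fun r => by have := hB r; fin_cases r <;> exact this)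
    (fun r => by have := hC r; fin_cases r <;> exact this) (hH ▸ hM) (hH ▸ hM')

/-- **Order 125: no `(5,5,3),(5,3,5),(3,5,5),(3,3,3)` sub-family** (Q3.8 = NO, kernel). [original] -/
theorem noSTPPSubfamily_125_553 : NoSTPPSubfamily 125 [(5,5,3),(5,3,5),(3,5,5),(3,3,3)] := by
  intro H _ _ hH N A B C h hs
  obtain ⟨A', B', C', h', hA, hB, hC⟩ := exists_four_of_hasSubfamilyShapes h hs
  exact no_553_535_355_333 h' hA hB hC hH

/-- **Order 111: no `(4,4,4)×3,(3,3,3)` sub-family** (Q3.9 = NO, kernel). [original] -/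
theorem noSTPPSubfamily_111 : NoSTPPSubfamily 111 [(4,4,4),(4,4,4),(4,4,4),(3,3,3)] := by
  intro H _ _ hH N A B C h hs
  obtain ⟨A', B', C', h', hA, hB, hC⟩ := exists_four_of_hasSubfamilyShapes h hs
  exact no_444_444_444_333 h' hA hB hC hH

/-- **Orders 120, 121: no `(4,4,4)×3 + (4,4,3)`, `(4,3,4)` or `(3,4,4)` sub-family** (Q3.10 = NO at both
orders, kernel). [original] -/
theorem noSTPPSubfamily_120_121 (M : ℕ) (hM : M = 120 ∨ M = 121) :
    NoSTPPSubfamily M [(4,4,4),(4,4,4),(4,4,4),(4,4,3)] ∧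
      NoSTPPSubfamily M [(4,4,4),(4,4,4),(4,4,4),(4,3,4)] ∧
        NoSTPPSubfamily M [(4,4,4),(4,4,4),(4,4,4),(3,4,4)] := by
  refine ⟨?_, ?_, ?_⟩ <;> intro H _ _ hH N A B C h hs
  · obtain ⟨A', B', C', h', hA, hB, hC⟩ := exists_four_of_hasSubfamilyShapes h hs
    exact no_444_444_444_443 h' hA hB hC (by rw [hH]; exact hM)
  · obtain ⟨A', B', C', h', hA, hB, hC⟩ := exists_four_of_hasSubfamilyShapes h hs
    exact no_444_444_444_434 h' hA hB hC (by rw [hH]; exact hM)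
  · obtain ⟨A', B', C', h', hA, hB, hC⟩ := exists_four_of_hasSubfamilyShapes h hs
    exact no_444_444_444_344 h' hA hB hC (by rw [hH]; exact hM)

/-- **Order 124: none of the four residual sub-families** `(5,4,3),(3,4,5),(4,4,4)×2` (and its two
rotations) or `(4,4,4)×4` (Q3.11 = NO, kernel). [original] -/
theorem noSTPPSubfamily_124 :
    NoSTPPSubfamily 124 [(5,4,3),(3,4,5),(4,4,4),(4,4,4)] ∧
      NoSTPPSubfamily 124 [(5,3,4),(3,5,4),(4,4,4),(4,4,4)] ∧
        NoSTPPSubfamily 124 [(4,5,3),(4,3,5),(4,4,4),(4,4,4)] ∧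
          NoSTPPSubfamily 124 [(4,4,4),(4,4,4),(4,4,4),(4,4,4)] := by
  refine ⟨?_, ?_, ?_, noSTPPSubfamily_four444 (by norm_num) (by norm_num)⟩ <;>
    intro H _ _ hH N A B C h hs
  · obtain ⟨A', B', C', h', hA, hB, hC⟩ := exists_four_of_hasSubfamilyShapes h hs
    exact no_543_345_444_444 h' hA hB hC hH
  · obtain ⟨A', B', C', h', hA, hB, hC⟩ := exists_four_of_hasSubfamilyShapes h hs
    exact no_534_354_444_444 h' hA hB hC hH
  · obtain ⟨A', B', C', h', hA, hB, hC⟩ := exists_four_of_hasSubfamilyShapes h hs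
    exact no_453_435_444_444 h' hA hB hC hH

/-- **Body of route crux `TEOrder125`** (draft route `AbelianSTPPCensus`, HOME/mm-stpp-plan/route/):
order 125 — no four `(4,4,4)` members and no `(5,5,3),(5,3,5),(3,5,5),(3,3,3)` sub-family. [original] -/
theorem teOrder125 :
    NoSTPPSubfamily 125 [(4,4,4),(4,4,4),(4,4,4),(4,4,4)] ∧
      NoSTPPSubfamily 125 [(5,5,3),(5,3,5),(3,5,5),(3,3,3)] :=
  ⟨noSTPPSubfamily_four444 (by norm_num) (by norm_num), noSTPPSubfamily_125_553⟩

/-- **Body of route crux `TEResidualSmall`**: the order-111 instance and the three order-120/121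
instances (Q3.9, Q3.10 = NO). [original] -/
theorem teResidualSmall :
    NoSTPPSubfamily 111 [(4,4,4),(4,4,4),(4,4,4),(3,3,3)] ∧
    (∀ M, M = 120 ∨ M = 121 → NoSTPPSubfamily M [(4,4,4),(4,4,4),(4,4,4),(4,4,3)] ∧
      NoSTPPSubfamily M [(4,4,4),(4,4,4),(4,4,4),(4,3,4)] ∧
        NoSTPPSubfamily M [(4,4,4),(4,4,4),(4,4,4),(3,4,4)]) :=
  ⟨noSTPPSubfamily_111, noSTPPSubfamily_120_121⟩

/-- **Body of route crux `TEResidualLarge`**: the four order-124 instances and `(4,4,4)×4` at orders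
126, 127 (Q3.11, Q3.12 = NO). [original] -/
theorem teResidualLarge :
    (NoSTPPSubfamily 124 [(5,4,3),(3,4,5),(4,4,4),(4,4,4)] ∧
      NoSTPPSubfamily 124 [(5,3,4),(3,5,4),(4,4,4),(4,4,4)] ∧
        NoSTPPSubfamily 124 [(4,5,3),(4,3,5),(4,4,4),(4,4,4)] ∧
          NoSTPPSubfamily 124 [(4,4,4),(4,4,4),(4,4,4),(4,4,4)]) ∧
    (∀ M, M = 126 ∨ M = 127 → NoSTPPSubfamily M [(4,4,4),(4,4,4),(4,4,4),(4,4,4)]) :=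
  ⟨noSTPPSubfamily_124, fun M hM =>
    noSTPPSubfamily_four444 (by rcases hM with rfl | rfl <;> norm_num)
      (by rcases hM with rfl | rfl <;> norm_num)⟩

end AbelianTECensus

end Summit.MatrixMultiplication.MatrixMultiplication.Theorems
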